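import Summits.CriticalPhenomena.PercolationContinuityZ3.Theorems.PercNearOneGluingNoHeavyLowerTailCILReduction
import HarnessLib

/-!
# `NoHeavyLowerTail` (stmt-CriticalPhenomena-4575) — the FLOOR-SPLIT cumulative isolation lemma (FSCIL) closes the crux

Typed target of lemma factory #5 (`prim-lf-5`, gen 7; memo `run/shared/lean/prim/prim-lf-5/CANDIDATES.md` v9, candidate
A13; census request `lf5-fscil-peeling`).  `--supports stmt-CriticalPhenomena-4575`.  No definitions, no named facts,
no sorries.

Notation: `μ = prodBernoulli w` on `Fin n`, relays `A`, observer `o ∉ A`, `N = |{x ∈ A : o ↔ x}|`,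
`N_a = |{x ∈ A : a ↔ x}|` (so `N_a ≥ 1`), level `j`.  Kozma–Nitzan's singleton ratio (their `φ`, Lemma 2 of
arXiv:2401.12397) is `φ_a := μ(o ↔ a, N_a = 1) / μ(N_a = 1)` (with Lean's convention `x / 0 = 0`), and KN Lemma 2 says
`Σ_a φ_a ≤ μ(o ↔ A)`.  The identity `μ(N = 1) = Σ_a φ_a μ(N_a = 1)` is the lonely-relay mechanism; at higher levels
`μ(1 ≤ N ≤ j) = Σ_a φ_a μ(N_a ≤ j) + EXC_j` with a nonnegative "Steiner excess" `EXC_j` (lead memo LEAD-GEN5 §4c).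

**FSCIL** (floor-split CIL) is the candidate inequality

  `μ(1 ≤ N ≤ j) ≤ Σ_{a ∈ A} φ_a · μ(N_a ≤ j) + (μ(o ↔ A) − Σ_{a ∈ A} φ_a) · max_{a ∈ A} μ(N_a ≤ j)`,

i.e. `EXC_j ≤ (total excess) × (champion lightness)`: the singleton floors pay their own relay's lightness and only the
excess mass pays the champion's.  It implies the SHARP cumulative isolation lemma `μ(1 ≤ N ≤ j) ≤ μ(o↔A)·max_a μ(N_a ≤ j)`
by one line of algebra, hence the crux through `Theorems.noHeavyLowerTail_of_stub_cumulativeIsolation`.  This file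
records exactly that: `noHeavyLowerTail_of_floorSplitCIL`.  The hypothesis is stated with an explicit maximiser `c`
(`∀ c ∈ A` dominating every `μ(N_a ≤ j)`), so no sign information on `μ(o↔A) − Σφ` is needed.

Evidence for the hypothesis (gen 7, exact partition-law engine `k ≤ 7`): 0 violations in 8,148 census instances and
37 annealed climbs; proved on paper for two-port one-layer observers (there `EXC_j = σ'·μ_{G−o}(|B_a ∪ B_b| ≤ j)`
exactly); it FAILS for partition laws violating the Harris inequality (uniform mixture of three crossing pair-blocks,
violation `1/96`), so any proof must use positive association of the relay partition.
-/

noncomputable section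

namespace Summit.CriticalPhenomena.PercolationContinuityZ3.Theorems

open MeasureTheory Set Literature.Probability.LatticeModels Literature.Probability.Percolation
open scoped Classical BigOperators

/-- **FSCIL closes the crux.**  If on every finite weighted graph, for every nonempty relay set `A`, observer
`o ∉ A`, level `j` and every relay `c ∈ A` whose lightness `μ(N_c ≤ j)` dominates all `μ(N_a ≤ j)`,
`μ(1 ≤ N ≤ j) ≤ Σ_a φ_a μ(N_a ≤ j) + (μ(o ↔ A) − Σ_a φ_a) μ(N_c ≤ j)` with
`φ_a = μ(o ↔ a, N_a = 1)/μ(N_a = 1)`, then `NoHeavyLowerTail` holds.  Proof: `φ_a ≥ 0` and `μ(N_a ≤ j) ≤ μ(N_c ≤ j)`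
give `RHS ≤ μ(o↔A)·μ(N_c ≤ j) ≤ μ(N_c ≤ j)`, which is the cumulative isolation lemma with witness `c`.
[this work; cite: KozmaNitzan2024, Lemma 2 (p. 6) for `φ`] -/
theorem noHeavyLowerTail_of_floorSplitCIL
    (hFS : ∀ (n : ℕ) (w : Sym2 (Fin n) → unitInterval) (A : Finset (Fin n)) (o : Fin n) (j : ℕ),
      A.Nonempty → o ∉ A → ∀ c ∈ A,
        (∀ a ∈ A,
          (prodBernoulli w).real {ω : BondConfig (Fin n) |
              (A.filter fun x => ω ∈ openConn a x).card ≤ j} ≤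
            (prodBernoulli w).real {ω : BondConfig (Fin n) |
              (A.filter fun x => ω ∈ openConn c x).card ≤ j}) →
        (prodBernoulli w).real {ω : BondConfig (Fin n) |
            1 ≤ (A.filter fun x => ω ∈ openConn o x).card ∧
              (A.filter fun x => ω ∈ openConn o x).card ≤ j} ≤
          (∑ a ∈ A,
              (prodBernoulli w).real
                  ((openConn o a : Set (BondConfig (Fin n))) ∩
                    {ω | (A.filter fun x => ω ∈ openConn a x).card = 1}) /
                (prodBernoulli w).real {ω : BondConfig (Fin n) |
                  (A.filter fun x => ω ∈ openConn a x).card = 1} *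
              (prodBernoulli w).real {ω : BondConfig (Fin n) |
                (A.filter fun x => ω ∈ openConn a x).card ≤ j}) +
            ((prodBernoulli w).real (⋃ a ∈ A, (openConn o a : Set (BondConfig (Fin n)))) -
                ∑ a ∈ A,
                  (prodBernoulli w).real
                      ((openConn o a : Set (BondConfig (Fin n))) ∩
                        {ω | (A.filter fun x => ω ∈ openConn a x).card = 1}) /
                    (prodBernoulli w).real {ω : BondConfig (Fin n) |
                      (A.filter fun x => ω ∈ openConn a x).card = 1}) *
              (prodBernoulli w).real {ω : BondConfig (Fin n) |
                (A.filter fun x => ω ∈ openConn c x).card ≤ j}) :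
    Summit.CriticalPhenomena.PercolationContinuityZ3.Theses.PercNearOneGluing.NoHeavyLowerTail := by
  refine noHeavyLowerTail_of_stub_cumulativeIsolation fun n w A o j hA ho => ?_
  set μ := prodBernoulli w with hμ
  -- lightness and floor weights
  set I : Fin n → ℝ := fun a =>
    μ.real {ω : BondConfig (Fin n) | (A.filter fun x => ω ∈ openConn a x).card ≤ j} with hI
  set φ : Fin n → ℝ := fun a =>
    μ.real ((openConn o a : Set (BondConfig (Fin n))) ∩
        {ω | (A.filter fun x => ω ∈ openConn a x).card = 1}) /
      μ.real {ω : BondConfig (Fin n) | (A.filter fun x => ω ∈ openConn a x).card = 1} with hφ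
  -- a champion `c`
  obtain ⟨c, hcA, hcmax⟩ := Finset.exists_max_image A I hA
  refine ⟨c, hcA, ?_⟩
  have hmain := hFS n w A o j hA ho c hcA (fun a ha => hcmax a ha)
  -- algebra: RHS ≤ μ(o↔A) · I c ≤ I c
  have hφnn : ∀ a, 0 ≤ φ a := fun a => by
    simp only [hφ]
    exact div_nonneg measureReal_nonneg measureReal_nonneg
  have hIc : 0 ≤ I c := by simp only [hI]; exact measureReal_nonneg
  have hP1 : μ.real (⋃ a ∈ A, (openConn o a : Set (BondConfig (Fin n)))) ≤ 1 := measureReal_le_one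
  have hsum : ∑ a ∈ A, φ a * I a ≤ ∑ a ∈ A, φ a * I c := by
    refine Finset.sum_le_sum fun a ha => ?_
    exact mul_le_mul_of_nonneg_left (hcmax a ha) (hφnn a)
  have hfac : ∑ a ∈ A, φ a * I c = (∑ a ∈ A, φ a) * I c := by rw [Finset.sum_mul]
  have key : (∑ a ∈ A, φ a * I a) +
      (μ.real (⋃ a ∈ A, (openConn o a : Set (BondConfig (Fin n)))) - ∑ a ∈ A, φ a) * I c ≤ I c := by
    nlinarith [hsum, hfac, hIc, hP1]
  exact le_trans hmain key

/-! ### The top level `j = |A| - 1`: FSCIL is the Harris inequality -/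

variable {n : ℕ}

/-- All relays lie in the cluster of the relay `a` iff they all lie in the cluster of the relay `c`
(both say: the relays are mutually joined). [folklore] -/
theorem FloorSplit.allConn_iff (A : Finset (Fin n)) {a c : Fin n} (ha : a ∈ A) (hc : c ∈ A)
    (ω : BondConfig (Fin n)) :
    (∀ x ∈ A, ω ∈ (openConn a x : Set (BondConfig (Fin n)))) ↔
      ∀ x ∈ A, ω ∈ (openConn c x : Set (BondConfig (Fin n))) := by
  constructor
  · intro h x hx
    exact ((h c hc).symm.trans (h x hx) : (openGraph ω).Reachable c x)
  · intro h x hx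
    exact ((h a ha).symm.trans (h x hx) : (openGraph ω).Reachable a x)

/-- `|π(v)| ≤ |A| - 1` iff some relay is not joined to `v` (for `A ≠ ∅`). [folklore] -/
theorem FloorSplit.card_le_pred_iff (A : Finset (Fin n)) (hA : A.Nonempty) (v : Fin n)
    (ω : BondConfig (Fin n)) :
    (A.filter fun x => ω ∈ openConn v x).card ≤ A.card - 1 ↔
      ¬ ∀ x ∈ A, ω ∈ (openConn v x : Set (BondConfig (Fin n))) := by
  have hpos : 0 < A.card := Finset.card_pos.2 hA
  constructor
  · intro h hall
    have : (A.filter fun x => ω ∈ openConn v x) = A := Finset.filter_true_of_mem hall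
    rw [this] at h
    omega
  · intro h
    have hlt : (A.filter fun x => ω ∈ openConn v x).card < A.card := by
      refine Finset.card_lt_card ⟨Finset.filter_subset _ _, fun hsub => h fun x hx => ?_⟩
      exact (Finset.mem_filter.1 (hsub hx)).2
    omega

/-- **FSCIL holds at the top level `j = |A| - 1`, where it IS the Harris inequality.**  For every relay set
`A`, observer `o`, relay `c ∈ A` and ANY nonnegative-or-not weights `φ_a` (in particular Kozma–Nitzan's singleton
ratios), `μ(1 ≤ N ≤ |A|-1) ≤ Σ_a φ_a μ(N_a ≤ |A|-1) + (μ(o↔A) − Σ_a φ_a) μ(N_c ≤ |A|-1)`: all the events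
`{N_a ≤ |A|-1}` coincide with `{relays not all joined}`, `{1 ≤ N ≤ |A|-1} = {o ↔ A} ∖ ({o ↔ A} ∩ {all joined})`,
and Harris (`prodBernoulli_harris`) gives `μ(o↔A) μ(all joined) ≤ μ(o ↔ A, all joined)`.  (So the floor-split CIL
interpolates between the lonely-relay identity at `j = 1` and Harris at `j = |A| - 1`.) [this work; cite: Grimmett1999, Thm. (2.4)] -/
theorem floorSplitCIL_topLevel (w : Sym2 (Fin n) → unitInterval) (A : Finset (Fin n)) (o c : Fin n)
    (hc : c ∈ A) (φ : Fin n → ℝ) :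
    (prodBernoulli w).real {ω : BondConfig (Fin n) |
        1 ≤ (A.filter fun x => ω ∈ openConn o x).card ∧
          (A.filter fun x => ω ∈ openConn o x).card ≤ A.card - 1} ≤
      (∑ a ∈ A, φ a *
          (prodBernoulli w).real {ω : BondConfig (Fin n) |
            (A.filter fun x => ω ∈ openConn a x).card ≤ A.card - 1}) +
        ((prodBernoulli w).real (⋃ a ∈ A, (openConn o a : Set (BondConfig (Fin n)))) - ∑ a ∈ A, φ a) *
          (prodBernoulli w).real {ω : BondConfig (Fin n) |
            (A.filter fun x => ω ∈ openConn c x).card ≤ A.card - 1} := by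
  set μ := prodBernoulli w with hμ
  have hA : A.Nonempty := ⟨c, hc⟩
  set X : Set (BondConfig (Fin n)) := ⋃ a ∈ A, (openConn o a : Set (BondConfig (Fin n))) with hX
  set Conn : Set (BondConfig (Fin n)) := {ω | ∀ x ∈ A, ω ∈ (openConn c x : Set (BondConfig (Fin n)))}
    with hConn
  -- every `{N_a ≤ |A|-1}` is `Connᶜ`
  have hIa : ∀ a ∈ A, {ω : BondConfig (Fin n) | (A.filter fun x => ω ∈ openConn a x).card ≤ A.card - 1} =
      Connᶜ := by
    intro a ha
    ext ω
    simp only [mem_setOf_eq, mem_compl_iff, FloorSplit.card_le_pred_iff A hA a ω, hConn,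
      FloorSplit.allConn_iff A ha hc ω]
  -- the bad event is `X ∖ (X ∩ Conn)` and `X ∩ Conn = {o joined to every relay}`
  have hbad : {ω : BondConfig (Fin n) |
      1 ≤ (A.filter fun x => ω ∈ openConn o x).card ∧
        (A.filter fun x => ω ∈ openConn o x).card ≤ A.card - 1} = X \ (X ∩ Conn) := by
    ext ω
    have hmemX : ω ∈ X ↔ 1 ≤ (A.filter fun x => ω ∈ openConn o x).card := by
      rw [Nat.succ_le_iff, Finset.card_pos, Finset.filter_nonempty_iff]
      simp only [hX, mem_iUnion, exists_prop]
    simp only [mem_setOf_eq, mem_sdiff, mem_inter_iff, hmemX, FloorSplit.card_le_pred_iff A hA o ω, hConn]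
    constructor
    · rintro ⟨h1, h2⟩
      refine ⟨h1, fun ⟨_, hall⟩ => h2 fun x hx => ?_⟩
      rw [Nat.succ_le_iff, Finset.card_pos, Finset.filter_nonempty_iff] at h1
      obtain ⟨a₀, ha₀, hoa₀⟩ := h1
      exact ((hoa₀ : (openGraph ω).Reachable o a₀).trans
        (((hall a₀ ha₀ : (openGraph ω).Reachable c a₀)).symm.trans (hall x hx)) : (openGraph ω).Reachable o x)
    · rintro ⟨h1, h2⟩
      refine ⟨h1, fun hall => h2 ⟨h1, fun x hx => ?_⟩⟩
      exact (((hall c hc : (openGraph ω).Reachable o c)).symm.trans (hall x hx) : (openGraph ω).Reachable c x)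
  -- Harris for the increasing events `X` and `Conn`
  have hXup : IsUpperSet X := isUpperSet_iUnion₂ fun a _ => isUpperSet_openConn o a
  have hCup : IsUpperSet Conn := by
    intro ω ω' hle hω x hx
    exact isUpperSet_openConn c x hle (hω x hx)
  have harris : μ.real X * μ.real Conn ≤ μ.real (X ∩ Conn) :=
    prodBernoulli_harris w hXup hCup MeasurableSet.of_discrete MeasurableSet.of_discrete
  -- measure bookkeeping
  have e1 : μ.real (X \ (X ∩ Conn)) = μ.real X - μ.real (X ∩ Conn) := by
    have := measureReal_inter_add_sdiff (μ := μ) (s := X)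
      (MeasurableSet.of_discrete : MeasurableSet (X ∩ Conn)) (measure_ne_top _ _)
    have e : X ∩ (X ∩ Conn) = X ∩ Conn := by rw [← inter_assoc, inter_self]
    rw [e] at this
    linarith
  have e2 : μ.real Connᶜ = 1 - μ.real Conn := by
    rw [measureReal_compl (μ := μ) MeasurableSet.of_discrete, probReal_univ]
  have hsum : ∑ a ∈ A, φ a * μ.real {ω : BondConfig (Fin n) |
      (A.filter fun x => ω ∈ openConn a x).card ≤ A.card - 1} = (∑ a ∈ A, φ a) * μ.real Connᶜ := by
    rw [Finset.sum_mul]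
    exact Finset.sum_congr rfl fun a ha => by rw [hIa a ha]
  rw [hbad, e1, hsum, hIa c hc, e2]
  have hX0 : 0 ≤ μ.real X := measureReal_nonneg
  nlinarith [harris, hX0]

end Summit.CriticalPhenomena.PercolationContinuityZ3.Theorems
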